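import Literature.Computability.QuantumComplexity.QAOARingObstruction
import Mathlib.Analysis.SpecialFunctions.Complex.LogBounds
import Mathlib.Analysis.Complex.ExponentialBounds
import HarnessLib

/-!
# QAOA at level 1 on regular graphs: the `0.6924` guarantee on 3-regular graphs (Farhi–Goldstone–Gutmann 2014, §5) and the `0.3032/√D` constant on triangle-free `D`-regular graphs (Hastings 2019, §3)

Topic `Literature/Computability/QuantumComplexity` (pub-qadeq lane); companion to
`QAOALevelOneMaxCut.lean` (which holds Wang–Hadfield–Jiang–Rieffel's Theorem 1 `edgeExpect_eq`, the
level-1 edge formula `levelOneEdge`, Corollary 1 `regularEdge_optimal` / `regularMax_two_bounds`, and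
FGG's `levelOne`, `meanCut`, `maxLevel`, `maxCut`), kept separate because the parent file is at the
gate's size limit. It PROVES the most quoted number about QAOA: FGG's abstract, “For p = 1, on
3-regular graphs the quantum algorithm always finds a cut that is at least 0.6924 times the size of
the optimal cut”, in the form the paper establishes it (§5): at the fixed angles `(γ*, β*) =
(arctan(1/√2), π/8)` the level-1 expectation satisfies `F₁(γ*, β*) ≥ 0.6924 · C(z)` for EVERY cut `z` of
EVERY 3-regular graph, hence `M₁ ≥ F₁(γ*, β*) ≥ 0.6924 · MaxCut`.

HONEST FRAMING: instance-level adjudication of specific advantage claims; no claim about BQP vs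
BPP or the summit. This is a statement about the level-1 expectation value; “finds a cut” refers to
sampling the measured cut near its mean (the parent file's `levelP_eq_meanCut` and its Chebyshev /
Markov bounds), and `0.6924` is below the guarantees of classical algorithms, as the paper says (“This
p = 1 result on 3-regular graphs is not as good as known classical algorithms”).

## Sources (held texts, read at the cited places)

* [FarhiGoldstoneGutmann2014] E. Farhi, J. Goldstone, S. Gutmann, *A Quantum Approximate Optimization
  Algorithm*, arXiv:1411.4028 (`lit read arxiv:1411.4028`, tex chunk p0008 = §5). Abstract: “For p =
  1, on 3-regular graphs the quantum algorithm always finds a cut that is at least 0.6924 times the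
  size of the optimal cut.” §5: “Suppose a 3-regular graph with n vertices (and accordingly 3n/2
  edges) contains T ‘isolated triangles’ and S ‘crossed squares’ … `F₁(γ,β) = S f_{g₄}(γ,β) + (4S +
  3T) f_{g₅}(γ,β) + (3n/2 − 5S − 3T) f_{g₆}(γ,β)` … a graph with S crossed squares and T isolated
  triangles must have at least one unsatisfied edge per crossed square and one unsatisfied edge per
  isolated triangle so the number of satisfied edges is `≤ (3n/2 − S − T)` … the quantum algorithm
  will produce an approximation ratio that is at least `M₁(n,S,T)/(3n/2 − S − T)` … It is
  straightforward to numerically evaluate (Y6) and we find that it achieves its minimum value at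
  `s = t = 0` and the value is `0.6924`. So we know that on any 3-regular graph, the QAOA will always
  produce a cut whose size is at least 0.6924 times the size of the optimal cut.” (The special case
  of the 4-vertex graph, “the only case where the analysis below does not apply”, has “approximation
  ratio … actually higher than 0.6924”.)
* [Hastings2019BoundedDepth] M. B. Hastings, *Classical and Quantum Bounded Depth Approximation Algorithms*,
  Quantum Inf. Comput. 19 (2019) 1116 = arXiv:1905.07047 (`lit read arxiv:1905.07047`, tex chunk p0009 =
  §3): “The optimal value of the parameters of the single step QAOA can be computed analytically,
  giving an expected fraction of edges cut (i.e., number of cut edges divided by N_e) equal to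
  `½ + (1/(2√D))(1 − 1/D)^{(D−1)/2} ≥ ½ + 0.3032/√D`, as shown in Refs. [wang2018quantum,
  ryan2018quantum]”; “we will say that an algorithm improves by a factor δ over random if the expected
  fraction of cut edges is at least `1/2 + δ`.”
* [WangHadfieldJiangRieffel2018] Z. Wang, S. Hadfield, Z. Jiang, E. G. Rieffel, Phys. Rev. A 97, 022304
  (2018), Thm. 1 (the edge expectation depends only on `(d_u, d_v, λ_{uv})`) and Cor. 1 (optimal
  angles `(arctan(1/√d), π/8)`; “For triangle-free 3-regular graph (d = 2), the ratio is 0.692”) —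
  both PROVED in the parent file.

## What is formalised, and how the printed argument is followed

FGG's subgraph types `g₆, g₅, g₄` of an edge of a 3-regular graph are, by WHJR's Theorem 1, the
values `λ_{uv} = 0, 1, 2` of the number of triangles through the edge (`edgeTriangles_le_two`: `λ ≤ 2`
in a 3-regular graph), and `f_{g₆}, f_{g₅}, f_{g₄}` at the angles `(γ*, β*)` are `f₆* = ½(1 + 2/(3√3))
∈ (0.6924, 0.6925)` (the parent's `regularEdge_optimal`, `regularMax_two_bounds`), `f₅* = f₆* − 1/18`,
`f₄* = f₆* − 1/9` (`levelOneEdge_gammaStar_betaStar`, from `cos² γ* = 2/3`, `cos 2γ* = 1/3`,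
`sin² 2β* = ½`). Where the paper evaluates the minimum over `(s, t)` numerically, we give the finite
certificate behind it at the fixed angles `(γ*, β*)` (which is what lower-bounds `M₁`): instead of the
global count “one unsatisfied edge per isolated triangle / crossed square” we charge every edge lying
in `λ_e ≥ 1` triangles the share `1/λ_e` to each of its triangles (`sum_edges_eq_sum_free_add_sum_triangles`,
double counting over `G.cliqueFinset 3`), and check per triangle that `Σ_{e ∈ t} (f*_{λ_e} − 0.6924·[e cut])/λ_e
≥ 0` because a cut satisfies at most two edges of a triangle (`cutInd_triangle_le_two`) —
`triangle_share_nonneg`; triangle-free edges satisfy `f₆* ≥ 0.6924` outright. This covers every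
3-regular graph including the 4-vertex one. Results: **`levelOne_gammaStar_betaStar_ge`**
(`0.6924 · C(z) ≤ F₁(γ*, β*)` for every cut `z`), **`maxCut_le_levelOne`** (`0.6924 · MaxCut ≤ F₁(γ*, β*)`)
and **`maxCut_le_maxLevel_one`** (`0.6924 · MaxCut ≤ M₁`).

Also (v2, Hastings 2019 §3): `hastings_const_le_regularMax` / `hastings_fraction_le`
(`½ + (1/(2√D))(1−1/D)^{(D−1)/2} ≥ ½ + 0.3032/√D`), `card_mul_hastings_le_maxLevel_one` (`M₁ ≥ |E|(½ +
0.3032/√D)` on triangle-free `D`-regular graphs, `D ≥ 2`) and `tendsto_sqrt_mul_regularMax`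
(`√D · regularMax → e^{−1/2}`: the improvement over random is `(1/(2√e) + o(1))/√D`).

Also (v3, importing `QAOARingObstruction.lean` for “bipartite ⇒ MaxCut = |E|”):
`maxLevel_one_eq_of_regular_cliqueFree` (`M₁ = |E|·½(1 + regularMax d)` on triangle-free
`(d+1)`-regular graphs — WHJR's optimal level-1 value), `maxLevel_one_eq_ratio_of_bipartite_regular`
(bipartite `D`-regular: the level-1 approximation RATIO is exactly `½(1 + (1/√D)(1−1/D)^{(D−1)/2})`) and
`maxLevel_one_ratio_bounds_of_bipartite_regular` (it lies in `[½ + 0.3032/√D, ½ + 1/(2√D)]`).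

NOT formalised: FGG's numerical minimisation over `(s, t)` as such (we certify the bound it asserts at
the minimising vertex's angles), the `p = 2` value `0.7559`, Hastings' classical threshold algorithms
(his `½ + 0.2812/√D` and the numerical comparison), and any other comparison with classical algorithms.

0 named facts, 0 sorry.
-/

noncomputable section

open Matrix Finset

namespace Literature.Computability.QuantumComplexity

namespace QAOA

variable {V : Type*} [Fintype V] [DecidableEq V] (G : SimpleGraph V) [DecidableRel G.Adj]

/-! ### The angles `(γ*, β*) = (arctan(1/√2), π/8)` and the three edge values -/

/-- **`γ* = arctan(1/√2)`**, the optimal level-1 angle for triangle-free 3-regular graphs. [cite: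
WangHadfieldJiangRieffel2018, §3 Cor. 1 (“one optimal pair of angles is (γ, β) = (arctan(1/√d),
π/8)”, d = 2)] -/
def gammaStar : ℝ := Real.arctan (1 / Real.sqrt 2)

/-- **`β* = π/8`.** [cite: WangHadfieldJiangRieffel2018, §3 Cor. 1] -/
def betaStar : ℝ := Real.pi / 8

/-- `cos² γ* = 2/3`. [folklore] -/
private theorem cos_gammaStar_sq : Real.cos gammaStar ^ 2 = 2 / 3 := by
  rw [gammaStar, Real.cos_arctan, div_pow, one_pow, Real.sq_sqrt (by positivity), div_pow, one_pow,
    Real.sq_sqrt (by norm_num)]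
  norm_num

/-- `cos 2γ* = 1/3`. [folklore] -/
private theorem cos_two_gammaStar : Real.cos (2 * gammaStar) = 1 / 3 := by
  rw [Real.cos_two_mul, cos_gammaStar_sq]
  norm_num

/-- `sin² 2β* = ½`. [folklore] -/
private theorem sin_two_betaStar_sq : Real.sin (2 * betaStar) ^ 2 = 1 / 2 := by
  rw [betaStar, show 2 * (Real.pi / 8) = Real.pi / 4 by ring, Real.sin_pi_div_four, div_pow,
    Real.sq_sqrt (by norm_num)]
  norm_num

/-- `f₆* := ½(1 + 2/(3√3))`, the optimal level-1 edge value of a triangle-free 3-regular graph. [cite: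
WangHadfieldJiangRieffel2018, §3 Cor. 1 (d = 2: “the ratio is 0.692”)] [cite: FarhiGoldstoneGutmann2014,
§5 (f_{g₆}, value 0.6924)] -/
def fSix : ℝ := 1 / 2 * (1 + regularMax 2)

/-- `sin 4β* · sin γ* · cos² γ* = regularMax 2 = 2/(3√3)` (Cor. 1 at its optimal angles). [cite:
WangHadfieldJiangRieffel2018, §3 Cor. 1] -/
private theorem sin_mul_sin_mul_cos_sq :
    Real.sin (4 * betaStar) * Real.sin gammaStar * Real.cos gammaStar ^ 2 = regularMax 2 := by
  have h := regularEdge_optimal (d := 2) (by norm_num)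
  rw [regularEdge] at h
  have e : Real.arctan (1 / Real.sqrt (2 : ℕ)) = gammaStar := by rw [Nat.cast_ofNat]; rfl
  rw [e, show Real.pi / 8 = betaStar from rfl] at h
  linarith

/-- **The three level-1 edge values of a 3-regular graph at `(γ*, β*)`** (FGG's `f_{g₆}, f_{g₅},
f_{g₄}` = WHJR's formula at `λ = 0, 1, 2`): `f₆*`, `f₆* − 1/18`, `f₆* − 1/9`. [cite:
FarhiGoldstoneGutmann2014, §5 (subgraph types g₄, g₅, g₆)] [cite: WangHadfieldJiangRieffel2018, §3 Thm.
1 (dependence on λ_uv)] -/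
theorem levelOneEdge_gammaStar_betaStar (lam : ℕ) (hlam : lam ≤ 2) :
    levelOneEdge 2 2 lam gammaStar betaStar =
      fSix - (if lam = 0 then 0 else if lam = 1 then 1 / 18 else 1 / 9) := by
  have hc2 := cos_gammaStar_sq
  have hkey : Real.sin (4 * betaStar) * Real.sin gammaStar * (2 / 3) = regularMax 2 := by
    rw [← hc2]; exact sin_mul_sin_mul_cos_sq
  rw [levelOneEdge, fSix, sin_two_betaStar_sq, cos_two_gammaStar]
  interval_cases lam
  · simp only [pow_zero, sub_self, mul_zero, sub_zero, if_true]
    rw [hc2]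
    linarith
  · rw [if_neg one_ne_zero, if_pos rfl, show 2 + 2 - 2 * 1 = 2 by norm_num, hc2, pow_one]
    linarith
  · rw [if_neg two_ne_zero, if_neg (by norm_num : (2 : ℕ) ≠ 1), show 2 + 2 - 2 * 2 = 0 by norm_num,
      pow_zero, hc2]
    linarith

/-- `0.6924 < f₆* < 0.6925`. [cite: FarhiGoldstoneGutmann2014, §5 (the value 0.6924)] -/
private theorem fSix_bounds : (0.6924 : ℝ) < fSix ∧ fSix < 0.6925 := regularMax_two_bounds

/-! ### Triangles through an edge of a 3-regular graph -/

/-- In a 3-regular graph an edge lies in at most two triangles (`λ_{uv} ≤ 2`: the subgraph types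
`g₆, g₅, g₄`). [cite: FarhiGoldstoneGutmann2014, §5 (the three subgraph types of an edge)] -/
theorem edgeTriangles_le_two (hreg : G.IsRegularOfDegree 3) {u v : V} (huv : G.Adj u v) :
    edgeTriangles G u v ≤ 2 := by
  rw [edgeTriangles]
  have hsub : G.neighborFinset u ∩ G.neighborFinset v ⊆ (G.neighborFinset u).erase v := by
    intro w hw
    rw [Finset.mem_inter, SimpleGraph.mem_neighborFinset, SimpleGraph.mem_neighborFinset] at hw
    exact Finset.mem_erase.2 ⟨fun h => G.loopless.irrefl _ (h ▸ hw.2), (G.mem_neighborFinset u w).2 hw.1⟩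
  refine (Finset.card_le_card hsub).trans ?_
  rw [Finset.card_erase_of_mem ((G.mem_neighborFinset u v).2 huv), G.card_neighborFinset_eq_degree,
    hreg.degree_eq u]

/-- The number of triangles of `G` containing both endpoints of `e` (well defined on `Sym2`). [cite:
WangHadfieldJiangRieffel2018, §3 Thm. 1 (λ_uv is the number of triangles in the graph containing edge
⟨uv⟩)] -/
def triCount (e : Sym2 V) : ℕ := #((G.cliqueFinset 3).filter fun t => ∀ a ∈ e, a ∈ t)

omit [Fintype V] [DecidableEq V] in
/-- Membership of both endpoints. [folklore] -/
private theorem forall_mem_mk {a b : V} {t : Finset V} : (∀ x ∈ s(a, b), x ∈ t) ↔ a ∈ t ∧ b ∈ t := by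
  constructor
  · exact fun h => ⟨h a (Sym2.mem_mk_left a b), h b (Sym2.mem_mk_right a b)⟩
  · rintro ⟨ha, hb⟩ x hx
    rcases Sym2.mem_iff.1 hx with rfl | rfl
    · exact ha
    · exact hb

/-- The triangles through `⟨uv⟩` are the `{u, v, w}` with `w` a common neighbour. [cite:
WangHadfieldJiangRieffel2018, §3 Thm. 1 (λ_uv)] -/
private theorem filter_triangles_eq_image {u v : V} (huv : G.Adj u v) :
    ((G.cliqueFinset 3).filter fun t => ∀ a ∈ s(u, v), a ∈ t) =
      (G.neighborFinset u ∩ G.neighborFinset v).image fun w => ({u, v, w} : Finset V) := by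
  have hne : u ≠ v := G.ne_of_adj huv
  ext t
  rw [Finset.mem_filter, SimpleGraph.mem_cliqueFinset_iff, Finset.mem_image, forall_mem_mk]
  constructor
  · rintro ⟨ht, hu, hv⟩
    have hcard : #(t \ {u, v}) = 1 := by
      rw [Finset.card_sdiff_of_subset (Finset.insert_subset hu (Finset.singleton_subset_iff.2 hv)), ht.card_eq,
        Finset.card_pair hne]
    obtain ⟨w, hw⟩ := Finset.card_eq_one.1 hcard
    have ht' : t = {u, v, w} := by
      have h1 : {u, v} ∪ (t \ {u, v}) = t :=
        Finset.union_sdiff_of_subset (Finset.insert_subset hu (Finset.singleton_subset_iff.2 hv))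
      rw [hw] at h1
      rw [← h1]
      ext x
      simp only [Finset.mem_union, Finset.mem_insert, Finset.mem_singleton]
      tauto
    rw [ht'] at ht
    have h3 := SimpleGraph.is3Clique_triple_iff.1 ht
    exact ⟨w, Finset.mem_inter.2 ⟨(G.mem_neighborFinset u w).2 h3.2.1, (G.mem_neighborFinset v w).2 h3.2.2⟩, ht'.symm⟩
  · rintro ⟨w, hw, rfl⟩
    rw [Finset.mem_inter, SimpleGraph.mem_neighborFinset, SimpleGraph.mem_neighborFinset] at hw
    exact ⟨SimpleGraph.is3Clique_triple_iff.2 ⟨huv, hw.1, hw.2⟩, by simp, by simp⟩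

/-- **`triCount ⟨uv⟩ = λ_{uv}`** for an edge. [cite: WangHadfieldJiangRieffel2018, §3 Thm. 1 (λ_uv is
the number of triangles containing edge ⟨uv⟩)] -/
theorem triCount_mk {u v : V} (huv : G.Adj u v) : triCount G s(u, v) = edgeTriangles G u v := by
  have hne : u ≠ v := G.ne_of_adj huv
  rw [triCount, filter_triangles_eq_image G huv, edgeTriangles, Finset.card_image_of_injOn]
  intro w hw w' hw' h
  have hwu : w ≠ u := fun e => by
    rw [e, Finset.coe_inter, Set.mem_inter_iff, Finset.mem_coe, SimpleGraph.mem_neighborFinset] at hw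
    exact G.loopless.irrefl _ hw.1
  have hwv : w ≠ v := fun e => by
    rw [e, Finset.coe_inter, Set.mem_inter_iff, Finset.mem_coe, Finset.mem_coe, SimpleGraph.mem_neighborFinset,
      SimpleGraph.mem_neighborFinset] at hw
    exact G.loopless.irrefl _ hw.2
  have hmem : w ∈ ({u, v, w'} : Finset V) := by
    have : w ∈ ({u, v, w} : Finset V) := by simp
    simpa only [h] using this
  rw [Finset.mem_insert, Finset.mem_insert, Finset.mem_singleton] at hmem
  rcases hmem with h1 | h2 | h3
  · exact absurd h1 hwu
  · exact absurd h2 hwv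
  · exact h3

/-! ### Double counting over triangles -/

/-- **Charging edges to their triangles:** `Σ_{e∈E} h(e) = Σ_{λ_e = 0} h(e) + Σ_{t a triangle}
Σ_{e ⊆ t} h(e)/λ_e` — FGG's bookkeeping of the edge sum by subgraph type, refined so that an edge in
`λ_e` triangles gives the share `1/λ_e` to each. [cite: FarhiGoldstoneGutmann2014, §5 (display “F₁(γ,β)
= S f_{g₄} + (4S + 3T) f_{g₅} + (3n/2 − 5S − 3T) f_{g₆}”)] -/
theorem sum_edges_eq_sum_free_add_sum_triangles (h : Sym2 V → ℝ) :
    ∑ e ∈ G.edgeFinset, h e =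
      ∑ e ∈ G.edgeFinset with triCount G e = 0, h e +
        ∑ t ∈ G.cliqueFinset 3, ∑ e ∈ G.edgeFinset with (∀ a ∈ e, a ∈ t), h e / triCount G e := by
  have hswap : ∑ t ∈ G.cliqueFinset 3, ∑ e ∈ G.edgeFinset with (∀ a ∈ e, a ∈ t), h e / triCount G e =
      ∑ e ∈ G.edgeFinset with triCount G e ≠ 0, h e := by
    simp_rw [Finset.sum_filter]
    rw [Finset.sum_comm]
    refine Finset.sum_congr rfl fun e _ => ?_
    rw [← Finset.sum_filter, Finset.sum_const, nsmul_eq_mul, ← triCount]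
    by_cases h0 : triCount G e = 0
    · rw [h0, if_neg (not_not.2 rfl), Nat.cast_zero, zero_mul]
    · rw [if_pos h0, mul_div_cancel₀ _ (Nat.cast_ne_zero.2 h0)]
  rw [hswap, Finset.sum_filter_add_sum_filter_not]

/-! ### The per-triangle certificate -/

omit [Fintype V] [DecidableEq V] in
/-- A cut satisfies at most two edges of a triangle. [cite: FarhiGoldstoneGutmann2014, §5 (“at least
one unsatisfied edge per … triangle”)] -/
theorem cutInd_triangle_le_two (z : V → Bool) (a b c : V) :
    cutInd z s(a, b) + cutInd z s(a, c) + cutInd z s(b, c) ≤ 2 := by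
  simp only [cutInd_mk]
  cases z a <;> cases z b <;> cases z c <;> simp

omit [Fintype V] [DecidableEq V] in
/-- The cut indicator is `0` or `1`. [folklore] -/
private theorem cutInd_le_one' (z : V → Bool) (a b : V) : cutInd z s(a, b) ≤ 1 := by
  rw [cutInd_mk]; split_ifs <;> simp

/-- The share of one edge: `g(λ, c) = (f*_λ − 0.6924·c)/λ` for `λ ∈ {1, 2}`, `c ∈ {0, 1}`, bounded
below by `0.2906` if the edge is uncut and by `−0.0556` if it is cut. [folklore] -/
private theorem share_ge {lam c : ℕ} (h1 : 1 ≤ lam) (h2 : lam ≤ 2) (hc : c ≤ 1) :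
    (0.2906 : ℝ) - 0.3462 * c ≤ (levelOneEdge 2 2 lam gammaStar betaStar - 0.6924 * c) / lam := by
  obtain ⟨hl, hu⟩ := fSix_bounds
  rw [levelOneEdge_gammaStar_betaStar lam h2]
  interval_cases lam <;> interval_cases c <;> norm_num <;> linarith

/-- The edges of `G` inside a triangle `{a, b, c}` are its three sides. [folklore] -/
private theorem filter_edges_triangle {a b c : V} (h : G.IsNClique 3 ({a, b, c} : Finset V)) :
    (G.edgeFinset.filter fun e => ∀ x ∈ e, x ∈ ({a, b, c} : Finset V)) = {s(a, b), s(a, c), s(b, c)} := by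
  have h3 := SimpleGraph.is3Clique_triple_iff.1 h
  ext e
  rw [Finset.mem_filter, SimpleGraph.mem_edgeFinset, Finset.mem_insert, Finset.mem_insert, Finset.mem_singleton]
  induction e using Sym2.ind with
  | h x y =>
    rw [SimpleGraph.mem_edgeSet, forall_mem_mk, Finset.mem_insert, Finset.mem_insert, Finset.mem_singleton,
      Finset.mem_insert, Finset.mem_insert, Finset.mem_singleton]
    constructor
    · rintro ⟨hxy, hx, hy⟩
      have hne := G.ne_of_adj hxy
      rcases hx with rfl | rfl | rfl <;> rcases hy with rfl | rfl | rfl <;>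
        first | exact absurd rfl hne | simp [Sym2.eq_swap]
    · rintro (h | h | h) <;> rw [Sym2.eq_iff] at h <;>
        rcases h with ⟨rfl, rfl⟩ | ⟨rfl, rfl⟩
      · exact ⟨h3.1, Or.inl rfl, Or.inr (Or.inl rfl)⟩
      · exact ⟨h3.1.symm, Or.inr (Or.inl rfl), Or.inl rfl⟩
      · exact ⟨h3.2.1, Or.inl rfl, Or.inr (Or.inr rfl)⟩
      · exact ⟨h3.2.1.symm, Or.inr (Or.inr rfl), Or.inl rfl⟩
      · exact ⟨h3.2.2, Or.inr (Or.inl rfl), Or.inr (Or.inr rfl)⟩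
      · exact ⟨h3.2.2.symm, Or.inr (Or.inr rfl), Or.inr (Or.inl rfl)⟩

/-- **The per-triangle certificate:** for every triangle `t` of a 3-regular graph and every cut `z`,
`Σ_{e ⊆ t} (f*_{λ_e} − 0.6924·[e cut])/λ_e ≥ 0` (each side lies in one or two triangles, at most two
sides are cut, and `0.2906 − 2·0.0556 > 0`). [cite: FarhiGoldstoneGutmann2014, §5 (“one unsatisfied
edge per isolated triangle / crossed square” and the minimum 0.6924 at s = t = 0)] -/
theorem triangle_share_nonneg (hreg : G.IsRegularOfDegree 3) {t : Finset V} (ht : t ∈ G.cliqueFinset 3)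
    (z : V → Bool) :
    0 ≤ ∑ e ∈ G.edgeFinset with (∀ a ∈ e, a ∈ t),
      (levelOneEdge 2 2 (triCount G e) gammaStar betaStar - 0.6924 * cutInd z e) / triCount G e := by
  rw [SimpleGraph.mem_cliqueFinset_iff] at ht
  obtain ⟨a, b, c, hab, hac, hbc, rfl⟩ := Finset.card_eq_three.1 ht.card_eq
  have h3 := SimpleGraph.is3Clique_triple_iff.1 ht
  rw [filter_edges_triangle G ht]
  have hne1 : s(a, b) ≠ s(a, c) := by rw [Ne, Sym2.eq_iff]; rintro (⟨-, h⟩ | ⟨h, -⟩) <;> [exact hbc h; exact hac h]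
  have hne2 : s(a, b) ≠ s(b, c) := by rw [Ne, Sym2.eq_iff]; rintro (⟨h, -⟩ | ⟨h, -⟩) <;> [exact hab h; exact hac h]
  have hne3 : s(a, c) ≠ s(b, c) := by rw [Ne, Sym2.eq_iff]; rintro (⟨h, -⟩ | ⟨h, -⟩) <;> [exact hab h; exact hac h]
  rw [Finset.sum_insert (by simp [hne1, hne2]), Finset.sum_insert (by simp [hne3]), Finset.sum_singleton]
  -- each side lies in 1 ≤ λ ≤ 2 triangles
  have tri_ge : ∀ {x y : V}, G.Adj x y → x ∈ ({a, b, c} : Finset V) → y ∈ ({a, b, c} : Finset V) →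
      1 ≤ triCount G s(x, y) := by
    intro x y hxy hx hy
    rw [triCount]
    exact Finset.card_pos.2 ⟨{a, b, c}, Finset.mem_filter.2 ⟨SimpleGraph.mem_cliqueFinset_iff.2 ht,
      forall_mem_mk.2 ⟨hx, hy⟩⟩⟩
  have tri_le : ∀ {x y : V}, G.Adj x y → triCount G s(x, y) ≤ 2 := by
    intro x y hxy
    rw [triCount_mk G hxy]
    exact edgeTriangles_le_two G hreg hxy
  have hab' := share_ge (tri_ge h3.1 (by simp) (by simp)) (tri_le h3.1) (cutInd_le_one' z a b)
  have hac' := share_ge (tri_ge h3.2.1 (by simp) (by simp)) (tri_le h3.2.1) (cutInd_le_one' z a c)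
  have hbc' := share_ge (tri_ge h3.2.2 (by simp) (by simp)) (tri_le h3.2.2) (cutInd_le_one' z b c)
  have hcut : (cutInd z s(a, b) : ℝ) + cutInd z s(a, c) + cutInd z s(b, c) ≤ 2 := by
    exact_mod_cast cutInd_triangle_le_two z a b c
  linarith

/-! ### Theorem: `F₁(γ*, β*) ≥ 0.6924 · C(z)` on every 3-regular graph -/

/-- Unfolding of the parent's edge formula. [folklore] -/
private theorem edgeFormula_mk' (γ β : ℝ) (u v : V) :
    edgeFormula G γ β s(u, v) = levelOneEdge (G.degree u - 1) (G.degree v - 1) (edgeTriangles G u v) γ β :=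
  rfl

/-- On a 3-regular graph the level-1 edge formula at `(γ*, β*)` is `f*_{λ_e}`. [cite:
WangHadfieldJiangRieffel2018, §3 Thm. 1] [cite: FarhiGoldstoneGutmann2014, §5] -/
private theorem edgeFormula_eq_of_regular (hreg : G.IsRegularOfDegree 3) {e : Sym2 V} (he : e ∈ G.edgeFinset) :
    edgeFormula G gammaStar betaStar e = levelOneEdge 2 2 (triCount G e) gammaStar betaStar := by
  induction e using Sym2.ind with
  | h u v =>
    have huv : G.Adj u v := SimpleGraph.mem_edgeFinset.1 he
    rw [edgeFormula_mk', hreg.degree_eq u, hreg.degree_eq v, triCount_mk G huv]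

/-- **Farhi–Goldstone–Gutmann §5: `F₁(γ*, β*) ≥ 0.6924 · C(z)` for every cut `z` of every 3-regular
graph** (at the fixed angles `γ* = arctan(1/√2)`, `β* = π/8`). [cite: FarhiGoldstoneGutmann2014, §5
(“on any 3-regular graph, the QAOA will always produce a cut whose size is at least 0.6924 times the
size of the optimal cut”)] -/
theorem levelOne_gammaStar_betaStar_ge (hreg : G.IsRegularOfDegree 3) (z : V → Bool) :
    (0.6924 : ℝ) * cutValue G z ≤ ∑ e ∈ G.edgeFinset, edgeFormula G gammaStar betaStar e := by
  rw [cutValue, Nat.cast_sum, Finset.mul_sum, ← sub_nonneg, ← Finset.sum_sub_distrib]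
  rw [Finset.sum_congr rfl fun e he => by rw [edgeFormula_eq_of_regular G hreg he]]
  rw [sum_edges_eq_sum_free_add_sum_triangles G
    (fun e => levelOneEdge 2 2 (triCount G e) gammaStar betaStar - 0.6924 * (cutInd z e : ℝ))]
  refine add_nonneg (Finset.sum_nonneg fun e he => ?_) (Finset.sum_nonneg fun t ht => triangle_share_nonneg G hreg ht z)
  rw [Finset.mem_filter] at he
  rw [he.2, levelOneEdge_gammaStar_betaStar 0 (by norm_num), if_pos rfl, sub_zero]
  have hc : (cutInd z e : ℝ) ≤ 1 := by
    induction e using Sym2.ind with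
    | h a b => exact_mod_cast cutInd_le_one' z a b
  obtain ⟨hl, -⟩ := fSix_bounds
  nlinarith

/-- **`F₁(γ*, β*) ≥ 0.6924 · C(z)`**, trace form: the level-1 QAOA expectation `tr[C Uρ₀U†]` at
`(γ*, β*)` is real and at least `0.6924 C(z)` for every cut `z`. [cite: FarhiGoldstoneGutmann2014, §5] -/
theorem levelOne_re_ge (hreg : G.IsRegularOfDegree 3) (z : V → Bool) :
    (0.6924 : ℝ) * cutValue G z ≤ (levelOne G gammaStar betaStar).re := by
  rw [levelOne_eq_sum_edgeFormula]
  have : (∑ e ∈ G.edgeFinset, (edgeFormula G gammaStar betaStar e : ℂ)).re =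
      ∑ e ∈ G.edgeFinset, edgeFormula G gammaStar betaStar e := by
    rw [← Complex.ofReal_sum, Complex.ofReal_re]
  rw [this]
  exact levelOne_gammaStar_betaStar_ge G hreg z

/-- **`0.6924 · MaxCut(G) ≤ F₁(γ*, β*)`** on every 3-regular graph. [cite: FarhiGoldstoneGutmann2014,
Abstract and §5 (“at least 0.6924 times the size of the optimal cut”)] -/
theorem maxCut_le_levelOne (hreg : G.IsRegularOfDegree 3) :
    (0.6924 : ℝ) * maxCut G ≤ (levelOne G gammaStar betaStar).re := by
  obtain ⟨z, -, hz⟩ := Finset.exists_mem_eq_sup (Finset.univ : Finset (V → Bool)) Finset.univ_nonempty (cutValue G)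
  rw [maxCut, hz]
  exact levelOne_re_ge G hreg z

/-- **`M₁ ≥ 0.6924 · MaxCut(G)` on every 3-regular graph:** the level-1 QAOA approximation ratio (in
expectation, at the best angles) is at least `0.6924`. [cite: FarhiGoldstoneGutmann2014, Abstract
(“For p = 1, on 3-regular graphs the quantum algorithm always finds a cut that is at least 0.6924 times
the size of the optimal cut”) and §5] -/
theorem maxCut_le_maxLevel_one (hreg : G.IsRegularOfDegree 3) :
    (0.6924 : ℝ) * maxCut G ≤ maxLevel G 1 := by
  have h1 := maxCut_le_levelOne G hreg
  have h2 : (levelOne G gammaStar betaStar).re = meanCut G 1 (fun _ => gammaStar) (fun _ => betaStar) := by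
    rw [← levelP_one G (fun _ => gammaStar) (fun _ => betaStar), levelP_eq_meanCut, Complex.ofReal_re]
  rw [h2] at h1
  exact h1.trans (meanCut_le_maxLevel G 1 _ _)


/-! ## Triangle-free `D`-regular graphs: the comparison constant `0.3032/√D` and its limit (Hastings 2019, §3)

Hastings §3: “The optimal value of the parameters of the single step QAOA can be computed
analytically, giving an expected fraction of edges cut … equal to `½ + (1/(2√D))(1 − 1/D)^{(D−1)/2}
≥ ½ + 0.3032/√D`, as shown in Refs. [WHJR 2018, Ryan-Anderson 2018]” — the left side is the parent
file's `½(1 + regularMax d)` with `D = d + 1` (`regularMax d = (1/√(d+1)) (d/(d+1))^{d/2}`), and the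
constant is `1/(2√e) = 0.30327…` (the parent's `regularMax_ge`); we also record the limit
`√D · regularMax → e^{−1/2}` behind it. -/

/-- **Hastings' inequality `(1/(2√D))(1 − 1/D)^{(D−1)/2} ≥ 0.3032/√D`**, in the parent's notation
(`D = d + 1`): `regularMax d ≥ 2·0.3032/√(d+1)`. [cite: Hastings2019BoundedDepth, §3 (display “½ +
(1/(2√D))(1 − 1/D)^{(D−1)/2} ≥ ½ + 0.3032/√D”)] -/
theorem hastings_const_le_regularMax (d : ℕ) : 2 * 0.3032 / Real.sqrt (d + 1) ≤ regularMax d := by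
  have h := regularMax_ge d
  have hd : (0 : ℝ) < Real.sqrt (d + 1) := Real.sqrt_pos.2 (by positivity)
  have he : Real.sqrt (Real.exp 1) < 1.6488 := by
    rw [Real.sqrt_lt' (by norm_num)]
    exact Real.exp_one_lt_d9.trans (by norm_num)
  have he0 : 0 < Real.sqrt (Real.exp 1) := Real.sqrt_pos.2 (Real.exp_pos 1)
  calc 2 * 0.3032 / Real.sqrt (d + 1) ≤ 1 / (Real.sqrt (Real.exp 1) * Real.sqrt (d + 1)) := by
        rw [div_le_div_iff₀ hd (mul_pos he0 hd)]
        nlinarith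
    _ ≤ regularMax d := h

/-- **The level-1 QAOA cut fraction on triangle-free `D`-regular graphs is at least `½ + 0.3032/√D`**
(Hastings' form of WHJR's Corollary 1). [cite: Hastings2019BoundedDepth, §3] [cite: WangHadfieldJiangRieffel2018,
§3 Cor. 1] -/
theorem hastings_fraction_le (d : ℕ) : 1 / 2 + 0.3032 / Real.sqrt (d + 1) ≤ 1 / 2 * (1 + regularMax d) := by
  have h := hastings_const_le_regularMax d
  have : 0.3032 / Real.sqrt (d + 1) = (2 * 0.3032 / Real.sqrt (d + 1)) / 2 := by ring
  rw [this]
  linarith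

/-- **`M₁ ≥ |E| (½ + 0.3032/√D)` on every triangle-free `D`-regular graph, `D ≥ 2`** (“an expected
fraction of edges cut … ≥ ½ + 0.3032/√D”). [cite: Hastings2019BoundedDepth, §3] [cite: WangHadfieldJiangRieffel2018,
§3 Cor. 1 (optimal angles (arctan(1/√d), π/8))] -/
theorem card_mul_hastings_le_maxLevel_one {d : ℕ} (hd : 0 < d) (hreg : G.IsRegularOfDegree (d + 1))
    (hG : G.CliqueFree 3) :
    (#G.edgeFinset : ℝ) * (1 / 2 + 0.3032 / Real.sqrt (d + 1)) ≤ maxLevel G 1 := by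
  set γ₁ : ℝ := Real.arctan (1 / Real.sqrt d)
  set β₁ : ℝ := Real.pi / 8
  have h1 : (levelOne G γ₁ β₁).re = #G.edgeFinset * (1 / 2 * (1 + regularMax d)) := by
    rw [levelOne_eq_of_regular_cliqueFree G hreg hG, Complex.ofReal_re, regularEdge_optimal hd]
  have h2 : (levelOne G γ₁ β₁).re = meanCut G 1 (fun _ => γ₁) (fun _ => β₁) := by
    rw [← levelP_one G (fun _ => γ₁) (fun _ => β₁), levelP_eq_meanCut, Complex.ofReal_re]
  calc (#G.edgeFinset : ℝ) * (1 / 2 + 0.3032 / Real.sqrt (d + 1))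
      ≤ #G.edgeFinset * (1 / 2 * (1 + regularMax d)) :=
        mul_le_mul_of_nonneg_left (hastings_fraction_le d) (Nat.cast_nonneg _)
    _ = meanCut G 1 (fun _ => γ₁) (fun _ => β₁) := by rw [← h1, h2]
    _ ≤ maxLevel G 1 := meanCut_le_maxLevel G 1 _ _

/-- `√(x^n) = (√x)^n` for `x ≥ 0`. [folklore] -/
private theorem sqrt_pow' {x : ℝ} (hx : 0 ≤ x) (n : ℕ) : Real.sqrt (x ^ n) = Real.sqrt x ^ n := by
  rw [← Real.sqrt_sq (pow_nonneg (Real.sqrt_nonneg x) n), ← pow_mul, mul_comm, pow_mul, Real.sq_sqrt hx]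

/-- **The constant is sharp in the limit: `√D · regularMax → e^{−1/2}`**, i.e. the QAOA₁ improvement
over random on triangle-free `D`-regular graphs is `(0.3033 + o(1))/√D` (the source of “0.3032”).
[cite: Hastings2019BoundedDepth, §3 (the display and “improves by a factor δ over random”)] [cite:
WangHadfieldJiangRieffel2018, §3 Cor. 1 (“(d/(d+1))^d > 1/e”)] -/
theorem tendsto_sqrt_mul_regularMax :
    Filter.Tendsto (fun d : ℕ => Real.sqrt (d + 1) * regularMax d) Filter.atTop
      (nhds (Real.exp (-(1 / 2)))) := by
  have hlim : Filter.Tendsto (fun d : ℕ => (Real.sqrt ((1 + 1 / (d : ℝ)) ^ d))⁻¹) Filter.atTop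
      (nhds (Real.exp (-(1 / 2)))) := by
    have h := ((Real.continuous_sqrt.tendsto _).comp (Real.tendsto_one_add_div_pow_exp 1)).inv₀
      (Real.sqrt_pos.2 (Real.exp_pos 1)).ne'
    rw [← Real.exp_half, ← Real.exp_neg, show -((1 : ℝ) / 2) = -(1 / 2) from rfl] at h
    exact h
  refine hlim.congr' ?_
  rw [Filter.EventuallyEq, Filter.eventually_atTop]
  refine ⟨1, fun d hd => ?_⟩
  have hd' : (0 : ℝ) < d := by exact_mod_cast hd
  have hd1 : (0 : ℝ) < d + 1 := by positivity
  unfold regularMax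
  rw [← mul_assoc, mul_one_div, div_self (Real.sqrt_pos.2 hd1).ne', one_mul, ← sqrt_pow' (by positivity),
    ← Real.sqrt_inv, ← inv_pow]
  congr 2
  field_simp


/-! ## The optimal level-1 value on triangle-free regular graphs and the approximation RATIO on bipartite regular graphs

WHJR Corollary 1 gives the optimal level-1 value `|E| · ½(1 + regularMax d)` on every triangle-free
`(d+1)`-regular graph; a bipartite graph is triangle-free and has `MaxCut = |E|` (BKKT §QAOA: “any
bipartite graph with a set of edges E has maximum cut size |E|”), so on bipartite `D`-regular graphs the
level-1 APPROXIMATION RATIO is exactly `½(1 + (1/√D)(1 − 1/D)^{(D−1)/2}) ≤ ½ + 1/(2√D)`. -/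

/-- **`M₁ = |E| · ½(1 + regularMax d)` on every triangle-free `(d+1)`-regular graph, `d ≥ 1`** (WHJR's
optimal level-1 value, attained at `(arctan(1/√d), π/8)`). [cite: WangHadfieldJiangRieffel2018, §3 Cor. 1
(eq. (15) and the optimal angles)] -/
theorem maxLevel_one_eq_of_regular_cliqueFree {d : ℕ} (hd : 0 < d) (hreg : G.IsRegularOfDegree (d + 1))
    (hG : G.CliqueFree 3) : maxLevel G 1 = #G.edgeFinset * (1 / 2 * (1 + regularMax d)) := by
  have hval : ∀ γ β : Fin 1 → ℝ, meanCut G 1 γ β = #G.edgeFinset * regularEdge d (γ 0) (β 0) := by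
    intro γ β
    have h := levelP_eq_meanCut G 1 γ β
    rw [levelP_one, levelOne_eq_of_regular_cliqueFree G hreg hG] at h
    exact_mod_cast h.symm
  refine le_antisymm (ciSup_le fun a => ?_) ?_
  · rw [hval]
    exact mul_le_mul_of_nonneg_left (regularEdge_le d _ _) (Nat.cast_nonneg _)
  · have h := meanCut_le_maxLevel G 1 (fun _ => Real.arctan (1 / Real.sqrt d)) (fun _ => Real.pi / 8)
    rwa [hval, regularEdge_optimal hd] at h

omit [Fintype V] [DecidableRel G.Adj] in
/-- A two-coloured (bipartite) graph has no triangle. [folklore] -/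
private theorem cliqueFree_three_of_twoColouring (c : V → Bool) (hc : ∀ a b, G.Adj a b → c a ≠ c b) :
    G.CliqueFree 3 := by
  intro t ht
  rw [SimpleGraph.is3Clique_iff] at ht
  obtain ⟨x, y, z, hxy, hxz, hyz, -⟩ := ht
  have h1 := hc x y hxy
  have h2 := hc x z hxz
  have h3 := hc y z hyz
  revert h1 h2 h3
  cases c x <;> cases c y <;> cases c z <;> decide

/-- `regularMax d ≤ 1/√(d+1)`. [folklore] -/
private theorem regularMax_le_inv_sqrt (d : ℕ) : regularMax d ≤ 1 / Real.sqrt (d + 1) := by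
  unfold regularMax
  have h1 : Real.sqrt ((d : ℝ) / (d + 1)) ^ d ≤ 1 := by
    apply pow_le_one₀ (Real.sqrt_nonneg _)
    rw [Real.sqrt_le_one]
    exact div_le_one_of_le₀ (by linarith) (by positivity)
  have h2 : 0 ≤ 1 / Real.sqrt ((d : ℝ) + 1) := by positivity
  calc 1 / Real.sqrt (d + 1) * Real.sqrt ((d : ℝ) / (d + 1)) ^ d ≤ 1 / Real.sqrt (d + 1) * 1 :=
        mul_le_mul_of_nonneg_left h1 h2
    _ = 1 / Real.sqrt (d + 1) := mul_one _

/-- **The level-1 approximation ratio on bipartite `(d+1)`-regular graphs is exactly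
`½(1 + regularMax d) = ½(1 + (1/√D)(1 − 1/D)^{(D−1)/2})`, `D = d + 1 ≥ 2`:** bipartite graphs are
triangle-free with `MaxCut = |E|`. [cite: WangHadfieldJiangRieffel2018, §3 Cor. 1] [cite:
BravyiKlieschKoenigTang2020, §QAOA (“any bipartite graph with a set of edges E has maximum cut size |E|
… the ratio between the expected value of the MaxCut cost function on the (optimal) level-p variational
state and the maximum cut size”)] -/
theorem maxLevel_one_eq_ratio_of_bipartite_regular {d : ℕ} (hd : 0 < d) (hreg : G.IsRegularOfDegree (d + 1))
    (c : V → Bool) (hc : ∀ a b, G.Adj a b → c a ≠ c b) :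
    maxLevel G 1 = 1 / 2 * (1 + regularMax d) * maxCut G := by
  rw [maxCut_eq_card_of_twoColouring G c hc,
    maxLevel_one_eq_of_regular_cliqueFree G hd hreg (cliqueFree_three_of_twoColouring G c hc), mul_comm]

/-- **Hence on bipartite `D`-regular graphs (`D ≥ 2`) the level-1 QAOA approximation ratio lies in
`[½ + 0.3032/√D, ½ + 1/(2√D)]`** — the `p = 1` case of the constant-depth limitation BKKT prove for all
`p` (“Such bounds were previously known only for p = 1”). [cite: WangHadfieldJiangRieffel2018, §3 Cor. 1]
[cite: Hastings2019BoundedDepth, §3] [cite: BravyiKlieschKoenigTang2020, §QAOA] -/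
theorem maxLevel_one_ratio_bounds_of_bipartite_regular {d : ℕ} (hd : 0 < d)
    (hreg : G.IsRegularOfDegree (d + 1)) (c : V → Bool) (hc : ∀ a b, G.Adj a b → c a ≠ c b) :
    (1 / 2 + 0.3032 / Real.sqrt (d + 1)) * maxCut G ≤ maxLevel G 1 ∧
      maxLevel G 1 ≤ (1 / 2 + 1 / (2 * Real.sqrt (d + 1))) * maxCut G := by
  rw [maxLevel_one_eq_ratio_of_bipartite_regular G hd hreg c hc]
  have hm : (0 : ℝ) ≤ maxCut G := Nat.cast_nonneg _
  refine ⟨mul_le_mul_of_nonneg_right (hastings_fraction_le d) hm, mul_le_mul_of_nonneg_right ?_ hm⟩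
  have h := regularMax_le_inv_sqrt d
  have : 1 / (2 * Real.sqrt (d + 1)) = (1 / Real.sqrt (d + 1)) / 2 := by ring
  rw [this]
  linarith

end QAOA

end Literature.Computability.QuantumComplexity
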